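import Summits.QuantumFields.BalabanUV.T4Continuum.Support.NE7TopFrameReadingSpikeLetters
import Summits.QuantumFields.BalabanUV.T4Continuum.Support.NE7TopNormalisedQbarLetters
import HarnessLib

/-!
# Support | NE7 (gen 98, ROAD-Γ′ S4a, part 1 — THE SPIKE LETTERS IN THE BINDER'S ENERGY CURRENCY): under a trivial accumulated top frame (`log v_{j+1} ≡ 0`) the corner spikes
# `S := gaugeDir W (spikeW M (framePotW L (j+1) W X))` carrying the residual top frame reading obey `‖S‖_w ≤ 2√((#Plane + d)·A₂)·(M·b)·‖X‖_w` and
# `x·Σ_{perWin(N·M)}‖curl_W S‖ ≤ 2·#Plane·A₁·(M²x)²·‖X‖_w²` (`‖·‖_w = energyNormW L (j+1) W · [0,N·M)^d`), `A₁, A₂` polynomials in `d, L, C1cov` and four geometric-sum ceilings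

Cell `pub-balaban`, rung (B)+1 sub-cell t4, lineage `b2b-balaban-t4-ne7-p1` (CRUX PROVER NE7 #1 = OWNER of row NE7), generation 98; memo `t4/b2b-balaban-t4-ne7-p1-g98/ROAD-G98.md` §1.
Pure composition of gen 97's spike letters BY NAME (`NE7TopFrameReadingSpikeLetters.dirSq_curlSq_spikes_le_of_top ∕ sum_norm_curl_spikes_le_of_top`) with the energy-norm
bookkeeping `M⁻²·l2sq X ≤ ‖X‖_w²` (`NE7TopNormalisedQbarLetters.inv_sq_mul_l2sq_le_energySq`).

WHY (memo ROAD-G97 §4 S4, ROAD-G98 §1).  The binder `hdecomp♭` (`NE7HintOfSliceNormalisationSU2Dec`) reads the normal part `X_N` through `‖X_N‖_w ≤ ν‖X‖_w` and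
`(ε∕M²)·Σ‖curl X_N‖ ≤ κ‖X‖_w²` with k-FREE `ν, κ`; gen 97's spike letters are stated against `l2sq X` with the raw tower sums `Σ_m L^mρ₂^m`, `(j+1)Σ_{i<j}(L²ρ₂)^i`, `Σ_{i<j}((L∕L^d)L)^i`,
`Σ_mρ₂^m` (`ρ₂ = L²∕L^d`).  THIS FILE converts them into the binder's currency with the sums replaced by CEILINGS `Γ₁…Γ₄` (hypotheses; at `d = 4`, `L = 2`: `Γ₁ = 2`, `Γ₂ = 1`
since `(j+1)j ≤ 4^{j+1}`, `Γ₃ = Γ₄ = 4∕3`): `ν_S = 2√((#Plane + d)A₂)·(Mb)` with `A₂ = 8192d³L⁵Γ₁ + 2048dL·K²Γ₂` (`K = C1cov·L²√(d(4L+1)^d)`), `κ_S = 2·#Plane·A₁·(M²x)²` with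
`A₁ = 16dL(6Γ₁ + 2Γ₄) + K₁Γ₃` (`K₁ = 64C1cov·L²d(4L+1)^d`) — small through the sup currency `Mb` and the plaquette currency `M²x` only.  Part 2 (`NE7TopNormalisedResidualLetters`)
adds the right-inverse piece and the tangency of the residual.
WHAT ([folklore]; 0 def, 0 sorry).  §1 bookkeeping (`mlog_vcov_eq_zero_of_frameTrivial`, `energyNormW_le_of_sq_le`, `sq_mul_le_sq_of_one_le`); §2 **`energyNormW_spikes_le_of_top`**,
**`curlL1_spikes_le_of_top`**.
HONEST FRAMING (page 1): composition and real arithmetic over landed kernel theorems; nothing of Bałaban's asserted; S2 (existence of a top-normalised representative), the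
`gaugeDir W μ` letters, `hdecomp♭` and NE7 are NOT proved; spine 0∕9; finite T⁴ rung (B)+1 — NOT infinite volume, NOT mass gap, NOT `BetaPertH`, NOT Clay.  Continuum YM on T⁴ ⇐
BetaPertH ∧ nine spine estimates (0/9 proved); BetaPertH ⇐ (D1) ∧ (D4) ∧ CAP+tail; G-an2-4 gates asym, D1 and NE2/3/4.
-/

set_option autoImplicit false

open scoped BigOperators Matrix Matrix.Norms.L2Operator
open NormedSpace Finset

namespace Summit.QuantumFields.BalabanUV.T4Continuum.NE7TopNormalisedSpikeEnergyLetters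

open Literature.MathematicalPhysics.QuantumFieldTheory.Balaban1983to89
open B7Prop1Explicit B7Prop2Explicit B7Prop3Flat MatrixLog
open T4AveragingDeficitWall (Ad IsUnitaryCfg IsSkewDir SmallField vary curl dirL1 dirSq curlSq)
open T4AveragingDeficitWallBoundary (IsPeriodicCfg periodBox)
open AveragingDeficitPeriodicCounting (IsPeriodicDir)
open AveragingDeficitMultiLevelPrep (cavgIter LevelSmall tower)
open B7Eq92Concrete (vcov)
open NE3TangentCovariantTower (dirIter QbarIter framePotW)
open NE3CovariantLineSumsL2 (l2sq l2sq_nonneg)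
open NE3.PairLandauB8Avg (relPert)
open ReplicationRightInverseBound (radSum)
open BlockAverageVaryHolo (nbRad)
open NE3CovariantLineSumsError (Csup)
open ShellMeasureAverageProp4General (C1cov C1cov_pos)
open BlockAveragePushDirGauge (gaugeDir)
open NE3CornerSpikes (spikeW)
open NE3EnergyWeightedShapes (energyNormW energyNormW_nonneg)
open NE3ProductPathBounds (energySq_nonneg)
open NE3EnergyHessContTwoTerm (curlSq_nonneg dirSq_nonneg)
open MinimalActionLevels (perWin)
open NE7TopFrameReadingSpikeLetters (dirSq_curlSq_spikes_le_of_top sum_norm_curl_spikes_le_of_top)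
open NE7TopNormalisedQbarLetters (inv_sq_mul_l2sq_le_energySq)

noncomputable section

variable {d : ℕ} {n : Type*} [Fintype n] [DecidableEq n]

/-! ## §1 Bookkeeping -/

/-- A trivial accumulated top frame has vanishing logarithm: `v ≡ 1 ⟹ mlog v ≡ 0`. [folklore] -/
theorem mlog_vcov_eq_zero_of_frameTrivial (L : ℕ) (W : Site d → Fin d → (Matrix n n ℂ)ˣ) (X : Site d → Fin d → Matrix n n ℂ) (j : ℕ)
    (hv1 : ∀ z : Site d, vcov L W (relPert W X) (j + 1) z = 1) (z : Site d) :
    mlog ((vcov L W (relPert W X) (j + 1) z : (Matrix n n ℂ)ˣ) : Matrix n n ℂ) = 0 := by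
  rw [hv1 z, Units.val_one, mlog_one]

/-- From a bound on the weighted energy SQUARE to a bound on the weighted energy norm: `curlSq + M⁻²dirSq ≤ c²`, `0 ≤ c` ⟹ `‖Z‖_w ≤ c`. [folklore] -/
theorem energyNormW_le_of_sq_le (L j : ℕ) (W : Site d → Fin d → (Matrix n n ℂ)ˣ) (Z : Site d → Fin d → Matrix n n ℂ) (F : Finset (Site d))
    {c : ℝ} (hc : 0 ≤ c) (h : curlSq W Z F + (((L : ℝ) ^ (j + 1))⁻¹) ^ 2 * dirSq Z F ≤ c ^ 2) :
    energyNormW L (j + 1) W Z F ≤ c := by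
  unfold energyNormW
  calc Real.sqrt (curlSq W Z F + (((L : ℝ) ^ (j + 1))⁻¹) ^ 2 * dirSq Z F) ≤ Real.sqrt (c ^ 2) := Real.sqrt_le_sqrt h
    _ = c := Real.sqrt_sq hc

omit [Fintype n] [DecidableEq n] in
/-- `x²·M² ≤ (M²·x)²` for `M ≥ 1`. [folklore] -/
theorem sq_mul_le_sq_of_one_le {M x : ℝ} (hM : 1 ≤ M) : x ^ 2 * M ^ 2 ≤ (M ^ 2 * x) ^ 2 := by
  have hM2 : 1 ≤ M ^ 2 := one_le_pow₀ hM
  have h0 : 0 ≤ x ^ 2 * M ^ 2 := by positivity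
  calc x ^ 2 * M ^ 2 = (x ^ 2 * M ^ 2) * 1 := (mul_one _).symm
    _ ≤ (x ^ 2 * M ^ 2) * M ^ 2 := mul_le_mul_of_nonneg_left hM2 h0
    _ = (M ^ 2 * x) ^ 2 := by ring

/-! ## §2 The spike letters in the binder's energy currency -/
set_option maxHeartbeats 400000 in
/-- **THE ν-LETTER OF THE SPIKES** (regime of `NE7TopFrameReadingSpikeLetters.dirSq_curlSq_spikes_le_of_top`; `M = L^{j+1}`, `M²x ≤ 1`, geometric-sum ceilings `Γ₁`, `Γ₂`):
`‖gaugeDir W (spikeW M (framePotW L (j+1) W X))‖_w ≤ 2√((#Plane + d)·A₂)·(M·b)·‖X‖_w`, `A₂ = 8192d³L⁵Γ₁ + 2048dL·K²Γ₂`, `K = C1cov·L²√(d(4L+1)^d)`. [folklore] -/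
theorem energyNormW_spikes_le_of_top [Nonempty n] {L N : ℕ} [NeZero N] (hL : 2 ≤ L) (hN : 1 ≤ N) (j : ℕ)
    {W : Site d → Fin d → (Matrix n n ℂ)ˣ} {x : ℝ} (hWu : IsUnitaryCfg W) (hWP : IsPeriodicCfg W ((N * L ^ (j + 1) : ℕ) : ℤ))
    (hx : 0 ≤ x) (hsm : LevelSmall d L j x) (hWx : SmallField W x) (hε : ((L : ℝ) ^ (j + 1)) ^ 2 * x ≤ 1)
    {α₀ b : ℝ} (hα : 0 < α₀) (hα3 : C0 d * (2 * α₀) ≤ 1 / 3) (hα4 : 4 * (2 * α₀) ≤ c2' d L)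
    (h52 : pdev W < α₀ * (((L : ℝ) ^ (j + 1))⁻¹) ^ 2) (hb : 0 ≤ b)
    {X : Site d → Fin d → Matrix n n ℂ} (hX : ∀ (y : Site d) (κ : Fin d), ‖X y κ‖ ≤ b) (hXP : IsPeriodicDir X ((N * L ^ (j + 1) : ℕ) : ℤ))
    (hsmall : Real.exp (4 * (800 * ((d : ℝ) + 1) ^ 2 * ((d : ℝ) + 4)) * α₀)
      * (1 + 8 * (131072 * ((d : ℝ) + 1) ^ 2) * ((L : ℝ) ^ (j + 1) * b)) ≤ 2)
    (hc₃ : 4 * ((L : ℝ) ^ (j + 1) * b) ≤ c3 d L)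
    (hK : 16 * (C1cov d * (L : ℝ) ^ 2 * Real.sqrt (d * (2 * (2 * L) + 1) ^ d)) * (L : ℝ) ^ (j + 1) * b ≤ Real.sqrt ((L : ℝ) ^ 2 / (L : ℝ) ^ d))
    (h44 : 44 * ((d : ℝ) * L * ((L : ℝ) ^ (j + 1) * b)) ≤ 1)
    (htop : ∀ z : Site d, mlog ((vcov L W (relPert W X) (j + 1) z : (Matrix n n ℂ)ˣ) : Matrix n n ℂ) = 0)
    {Γ₁ Γ₂ : ℝ} (hΓ₁ : ∑ m ∈ range (j + 1), (L : ℝ) ^ m * ((L : ℝ) ^ 2 / (L : ℝ) ^ d) ^ m ≤ Γ₁)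
    (hΓ₂ : ((j : ℝ) + 1) * ∑ i ∈ range j, ((L : ℝ) ^ 2 * ((L : ℝ) ^ 2 / (L : ℝ) ^ d)) ^ i ≤ Γ₂ * ((L : ℝ) ^ (j + 1)) ^ 2) :
    energyNormW L (j + 1) W (gaugeDir W (spikeW (L ^ (j + 1)) (framePotW L (j + 1) W X))) (periodBox (d := d) (N * L ^ (j + 1)))
      ≤ 2 * Real.sqrt (((Fintype.card (T4AveragingDeficitWall.Plane d) : ℝ) + d)
            * (8192 * ((d : ℝ) ^ 3 * (L : ℝ) ^ 5) * Γ₁ + 2048 * ((d : ℝ) * L) * (C1cov d * (L : ℝ) ^ 2 * Real.sqrt (d * (2 * (2 * L) + 1) ^ d)) ^ 2 * Γ₂))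
          * ((L : ℝ) ^ (j + 1) * b) * energyNormW L (j + 1) W X (periodBox (d := d) (N * L ^ (j + 1))) := by
  have hL0 : (0 : ℝ) < L := by exact_mod_cast (show 0 < L by omega)
  -- the spike letters, fetched BEFORE the abbreviations so that `set` rewrites them
  have hsp := dirSq_curlSq_spikes_le_of_top hL hN j hWu hWP hx hsm hWx hα hα3 hα4 h52 hb hX hXP hsmall hc₃ hK h44 htop
  rw [show L ^ (j + 1) * N = N * L ^ (j + 1) from Nat.mul_comm _ _] at hsp
  set M : ℝ := (L : ℝ) ^ (j + 1) with hMdef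
  have hM0 : 0 < M := by positivity
  have hM1 : 1 ≤ M := one_le_pow₀ (by exact_mod_cast (show 1 ≤ L by omega))
  set K : ℝ := C1cov d * (L : ℝ) ^ 2 * Real.sqrt (d * (2 * (2 * L) + 1) ^ d) with hKdef
  have hK0 : 0 ≤ K := by rw [hKdef]; have := C1cov_pos d; positivity
  set P : ℝ := (Fintype.card (T4AveragingDeficitWall.Plane d) : ℝ) with hPdef
  have hP0 : 0 ≤ P := by rw [hPdef]; positivity
  set F := periodBox (d := d) (N * L ^ (j + 1)) with hF
  set l2 : ℝ := l2sq F X with hl2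
  have hl20 : 0 ≤ l2 := l2sq_nonneg _ _
  set E : ℝ := energyNormW L (j + 1) W X F with hE
  have hE0 : 0 ≤ E := energyNormW_nonneg _ _ _ _ _
  set G₁ : ℝ := ∑ m ∈ range (j + 1), (L : ℝ) ^ m * ((L : ℝ) ^ 2 / (L : ℝ) ^ d) ^ m with hG₁
  set G₂ : ℝ := ∑ i ∈ range j, ((L : ℝ) ^ 2 * ((L : ℝ) ^ 2 / (L : ℝ) ^ d)) ^ i with hG₂
  have hG₁0 : 0 ≤ G₁ := by rw [hG₁]; exact Finset.sum_nonneg fun _ _ => by positivity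
  have hG₂0 : 0 ≤ G₂ := by rw [hG₂]; exact Finset.sum_nonneg fun _ _ => by positivity
  have hΓ₁0 : 0 ≤ Γ₁ := hG₁0.trans hΓ₁
  have hΓ₂0 : 0 ≤ Γ₂ := by
    have h : 0 * M ^ 2 ≤ Γ₂ * M ^ 2 := by rw [zero_mul]; exact le_trans (by positivity) hΓ₂
    exact le_of_mul_le_mul_right h (by positivity)
  set T₂ : ℝ := 2 * (4096 * ((d : ℝ) ^ 3 * (L : ℝ) ^ 5) * b ^ 2 * M * G₁ * l2)
      + 2 * (((j : ℝ) + 1) * (((d : ℝ) * L) * (1024 * K ^ 2 * b ^ 2 * G₂ * l2))) with hT₂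
  obtain ⟨hdir, hcurl⟩ := hsp
  -- `T₂ ≤ A₂·(Mb)²·l2`
  set A₂ : ℝ := 8192 * ((d : ℝ) ^ 3 * (L : ℝ) ^ 5) * Γ₁ + 2048 * ((d : ℝ) * L) * K ^ 2 * Γ₂ with hA₂
  have hA₂0 : 0 ≤ A₂ := by rw [hA₂]; positivity
  have hMM : M ≤ M * M := le_mul_of_one_le_left hM0.le hM1
  have hT₂le : T₂ ≤ A₂ * (M * b) ^ 2 * l2 := by
    have h1 : 2 * (4096 * ((d : ℝ) ^ 3 * (L : ℝ) ^ 5) * b ^ 2 * M * G₁ * l2) ≤ 8192 * ((d : ℝ) ^ 3 * (L : ℝ) ^ 5) * Γ₁ * (M * b) ^ 2 * l2 := by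
      have e : 2 * (4096 * ((d : ℝ) ^ 3 * (L : ℝ) ^ 5) * b ^ 2 * M * G₁ * l2) = 8192 * ((d : ℝ) ^ 3 * (L : ℝ) ^ 5) * G₁ * M * (b ^ 2 * l2) := by ring
      have e' : 8192 * ((d : ℝ) ^ 3 * (L : ℝ) ^ 5) * Γ₁ * (M * b) ^ 2 * l2 = 8192 * ((d : ℝ) ^ 3 * (L : ℝ) ^ 5) * Γ₁ * (M * M) * (b ^ 2 * l2) := by ring
      rw [e, e']
      calc 8192 * ((d : ℝ) ^ 3 * (L : ℝ) ^ 5) * G₁ * M * (b ^ 2 * l2) ≤ 8192 * ((d : ℝ) ^ 3 * (L : ℝ) ^ 5) * Γ₁ * M * (b ^ 2 * l2) := by gcongr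
        _ ≤ 8192 * ((d : ℝ) ^ 3 * (L : ℝ) ^ 5) * Γ₁ * (M * M) * (b ^ 2 * l2) := by gcongr
    have h2 : 2 * (((j : ℝ) + 1) * (((d : ℝ) * L) * (1024 * K ^ 2 * b ^ 2 * G₂ * l2))) ≤ 2048 * ((d : ℝ) * L) * K ^ 2 * Γ₂ * (M * b) ^ 2 * l2 := by
      have e : 2 * (((j : ℝ) + 1) * (((d : ℝ) * L) * (1024 * K ^ 2 * b ^ 2 * G₂ * l2)))
          = 2048 * ((d : ℝ) * L) * K ^ 2 * (((j : ℝ) + 1) * G₂) * (b ^ 2 * l2) := by ring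
      have e' : 2048 * ((d : ℝ) * L) * K ^ 2 * Γ₂ * (M * b) ^ 2 * l2 = 2048 * ((d : ℝ) * L) * K ^ 2 * (Γ₂ * M ^ 2) * (b ^ 2 * l2) := by ring
      rw [e, e']
      gcongr
    rw [hT₂, hA₂]
    calc 2 * (4096 * ((d : ℝ) ^ 3 * (L : ℝ) ^ 5) * b ^ 2 * M * G₁ * l2) + 2 * (((j : ℝ) + 1) * (((d : ℝ) * L) * (1024 * K ^ 2 * b ^ 2 * G₂ * l2)))
        ≤ 8192 * ((d : ℝ) ^ 3 * (L : ℝ) ^ 5) * Γ₁ * (M * b) ^ 2 * l2 + 2048 * ((d : ℝ) * L) * K ^ 2 * Γ₂ * (M * b) ^ 2 * l2 := add_le_add h1 h2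
      _ = (8192 * ((d : ℝ) ^ 3 * (L : ℝ) ^ 5) * Γ₁ + 2048 * ((d : ℝ) * L) * K ^ 2 * Γ₂) * (M * b) ^ 2 * l2 := by ring
  -- `l2 ≤ M²·E²`
  have hl2E : l2 ≤ M ^ 2 * E ^ 2 := by
    have h := inv_sq_mul_l2sq_le_energySq L j W X F
    have hM2 : 0 < M ^ 2 := by positivity
    have e : l2 = M ^ 2 * ((M ^ 2)⁻¹ * l2) := by field_simp
    rw [e]; exact mul_le_mul_of_nonneg_left h hM2.le
  have hT₂E : T₂ ≤ A₂ * (M * b) ^ 2 * (M ^ 2 * E ^ 2) := hT₂le.trans (mul_le_mul_of_nonneg_left hl2E (by positivity))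
  -- the weighted energy square
  have hx2 : x ^ 2 * M ^ 2 ≤ 1 := by
    have h := sq_mul_le_sq_of_one_le (x := x) hM1
    have h0 : 0 ≤ M ^ 2 * x := by positivity
    have h1 : (M ^ 2 * x) ^ 2 ≤ 1 := by
      calc (M ^ 2 * x) ^ 2 = (M ^ 2 * x) * (M ^ 2 * x) := sq _
        _ ≤ 1 * 1 := mul_le_mul hε hε h0 zero_le_one
        _ = 1 := one_mul _
    exact h.trans h1
  set c : ℝ := 2 * Real.sqrt ((P + d) * A₂) * (M * b) * E with hc
  have hc0 : 0 ≤ c := by rw [hc]; positivity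
  refine energyNormW_le_of_sq_le L j W _ F hc0 ?_
  have hsq : Real.sqrt ((P + d) * A₂) ^ 2 = (P + d) * A₂ := Real.sq_sqrt (by positivity)
  have e : c ^ 2 = 4 * ((P + d) * A₂) * (M * b) ^ 2 * E ^ 2 := by
    rw [hc]
    calc (2 * Real.sqrt ((P + d) * A₂) * (M * b) * E) ^ 2 = 4 * Real.sqrt ((P + d) * A₂) ^ 2 * (M * b) ^ 2 * E ^ 2 := by ring
      _ = 4 * ((P + d) * A₂) * (M * b) ^ 2 * E ^ 2 := by rw [hsq]
  rw [e]
  have hMinv : (M⁻¹) ^ 2 * (M ^ 2 * E ^ 2) = E ^ 2 := by field_simp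
  calc curlSq W (gaugeDir W (spikeW (L ^ (j + 1)) (framePotW L (j + 1) W X))) F
        + (M⁻¹) ^ 2 * dirSq (gaugeDir W (spikeW (L ^ (j + 1)) (framePotW L (j + 1) W X))) F
      ≤ 4 * x ^ 2 * P * T₂ + (M⁻¹) ^ 2 * (4 * (d : ℝ) * T₂) := add_le_add hcurl (mul_le_mul_of_nonneg_left hdir (by positivity))
    _ ≤ 4 * x ^ 2 * P * (A₂ * (M * b) ^ 2 * (M ^ 2 * E ^ 2)) + (M⁻¹) ^ 2 * (4 * (d : ℝ) * (A₂ * (M * b) ^ 2 * (M ^ 2 * E ^ 2))) := by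
        gcongr
    _ = 4 * (x ^ 2 * M ^ 2) * P * (A₂ * (M * b) ^ 2 * E ^ 2) + 4 * (d : ℝ) * (A₂ * (M * b) ^ 2 * ((M⁻¹) ^ 2 * (M ^ 2 * E ^ 2))) := by ring
    _ = 4 * (x ^ 2 * M ^ 2) * P * (A₂ * (M * b) ^ 2 * E ^ 2) + 4 * (d : ℝ) * (A₂ * (M * b) ^ 2 * E ^ 2) := by rw [hMinv]
    _ ≤ 4 * 1 * P * (A₂ * (M * b) ^ 2 * E ^ 2) + 4 * (d : ℝ) * (A₂ * (M * b) ^ 2 * E ^ 2) := by gcongr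
    _ = 4 * ((P + d) * A₂) * (M * b) ^ 2 * E ^ 2 := by ring

/-- **THE κ-LETTER OF THE SPIKES** (regime of `NE7TopFrameReadingSpikeLetters.sum_norm_curl_spikes_le_of_top`; geometric-sum ceilings `Γ₁`, `Γ₃`, `Γ₄`):
`x·Σ_{p∈perWin(N·M)}‖curl_W (gaugeDir W (spikeW M f)) p‖ ≤ 2·#Plane·A₁·(M²x)²·‖X‖_w²`, `A₁ = 16dL(6Γ₁ + 2Γ₄) + K₁Γ₃`, `K₁ = 64C1cov·L²d(4L+1)^d`. [folklore] -/
theorem curlL1_spikes_le_of_top [Nonempty n] {L N : ℕ} (hL : 2 ≤ L) (hN : 1 ≤ N) (j : ℕ)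
    {W : Site d → Fin d → (Matrix n n ℂ)ˣ} {x : ℝ} (hWu : IsUnitaryCfg W) (hWP : IsPeriodicCfg W ((N * L ^ (j + 1) : ℕ) : ℤ))
    (hx : 0 ≤ x) (hsm : LevelSmall d L j x) (hWx : SmallField W x)
    {α₀ b : ℝ} (hα : 0 < α₀) (hα3 : C0 d * (2 * α₀) ≤ 1 / 3) (hα4 : 4 * (2 * α₀) ≤ c2' d L)
    (h52 : pdev W < α₀ * (((L : ℝ) ^ (j + 1))⁻¹) ^ 2) (hb : 0 ≤ b)
    {X : Site d → Fin d → Matrix n n ℂ} (hX : ∀ (y : Site d) (κ : Fin d), ‖X y κ‖ ≤ b) (hXP : IsPeriodicDir X ((N * L ^ (j + 1) : ℕ) : ℤ))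
    (hsmall : Real.exp (4 * (800 * ((d : ℝ) + 1) ^ 2 * ((d : ℝ) + 4)) * α₀)
      * (1 + 8 * (131072 * ((d : ℝ) + 1) ^ 2) * ((L : ℝ) ^ (j + 1) * b)) ≤ 2)
    (hc₃ : 4 * ((L : ℝ) ^ (j + 1) * b) ≤ c3 d L)
    (hK : 16 * (C1cov d * (L : ℝ) ^ 2 * Real.sqrt (d * (2 * (2 * L) + 1) ^ d)) * (L : ℝ) ^ (j + 1) * b ≤ Real.sqrt ((L : ℝ) ^ 2 / (L : ℝ) ^ d))
    (hS1 : (16 * (d + 1) * (d + 4) * (L : ℝ) ^ 2 * Csup d L * (d * (2 * nbRad d L + 1) ^ d)) * radSum d L j x ≤ ((L : ℝ) / (L : ℝ) ^ d) / 2)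
    (h44 : 44 * ((d : ℝ) * L * ((L : ℝ) ^ (j + 1) * b)) ≤ 1)
    (htop : ∀ z : Site d, mlog ((vcov L W (relPert W X) (j + 1) z : (Matrix n n ℂ)ˣ) : Matrix n n ℂ) = 0)
    {Γ₁ Γ₃ Γ₄ : ℝ} (hΓ₁ : ∑ m ∈ range (j + 1), (L : ℝ) ^ m * ((L : ℝ) ^ 2 / (L : ℝ) ^ d) ^ m ≤ Γ₁)
    (hΓ₃ : ∑ i ∈ range j, (((L : ℝ) / (L : ℝ) ^ d) * L) ^ i ≤ Γ₃) (hΓ₄ : ∑ m ∈ range (j + 1), ((L : ℝ) ^ 2 / (L : ℝ) ^ d) ^ m ≤ Γ₄) :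
    x * ∑ p ∈ perWin d (N * L ^ (j + 1)), ‖curl W (gaugeDir W (spikeW (L ^ (j + 1)) (framePotW L (j + 1) W X))) p‖
      ≤ 2 * (Fintype.card (T4AveragingDeficitWall.Plane d) : ℝ)
          * (16 * ((d : ℝ) * L) * (6 * Γ₁ + 2 * Γ₄) + 64 * (C1cov d * (L : ℝ) ^ 2 * (d * (2 * (2 * (L : ℝ)) + 1) ^ d)) * Γ₃)
          * (((L : ℝ) ^ (j + 1)) ^ 2 * x) ^ 2 * energyNormW L (j + 1) W X (periodBox (d := d) (N * L ^ (j + 1))) ^ 2 := by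
  have hL0 : (0 : ℝ) < L := by exact_mod_cast (show 0 < L by omega)
  have hsp := sum_norm_curl_spikes_le_of_top hL hN j hWu hWP hx hsm hWx hα hα3 hα4 h52 hb hX hXP hsmall hc₃ hK hS1 h44 htop
  rw [show L ^ (j + 1) * N = N * L ^ (j + 1) from Nat.mul_comm _ _] at hsp
  set M : ℝ := (L : ℝ) ^ (j + 1) with hMdef
  have hM0 : 0 < M := by positivity
  have hM1 : 1 ≤ M := one_le_pow₀ (by exact_mod_cast (show 1 ≤ L by omega))
  set K₁ : ℝ := 64 * (C1cov d * (L : ℝ) ^ 2 * (d * (2 * (2 * (L : ℝ)) + 1) ^ d)) with hK₁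
  have hK₁0 : 0 ≤ K₁ := by rw [hK₁]; have := C1cov_pos d; positivity
  set P : ℝ := (Fintype.card (T4AveragingDeficitWall.Plane d) : ℝ) with hPdef
  have hP0 : 0 ≤ P := by rw [hPdef]; positivity
  set F := periodBox (d := d) (N * L ^ (j + 1)) with hF
  set l2 : ℝ := l2sq F X with hl2
  have hl20 : 0 ≤ l2 := l2sq_nonneg _ _
  set E : ℝ := energyNormW L (j + 1) W X F with hE
  have hE0 : 0 ≤ E := energyNormW_nonneg _ _ _ _ _
  set G₁ : ℝ := ∑ m ∈ range (j + 1), (L : ℝ) ^ m * ((L : ℝ) ^ 2 / (L : ℝ) ^ d) ^ m with hG₁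
  set G₃ : ℝ := ∑ i ∈ range j, (((L : ℝ) / (L : ℝ) ^ d) * L) ^ i with hG₃
  set G₄ : ℝ := ∑ m ∈ range (j + 1), ((L : ℝ) ^ 2 / (L : ℝ) ^ d) ^ m with hG₄
  have hG₁0 : 0 ≤ G₁ := by rw [hG₁]; exact Finset.sum_nonneg fun _ _ => by positivity
  have hG₃0 : 0 ≤ G₃ := by rw [hG₃]; exact Finset.sum_nonneg fun _ _ => by positivity
  have hG₄0 : 0 ≤ G₄ := by rw [hG₄]; exact Finset.sum_nonneg fun _ _ => by positivity
  have hΓ₁0 : 0 ≤ Γ₁ := hG₁0.trans hΓ₁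
  have hΓ₃0 : 0 ≤ Γ₃ := hG₃0.trans hΓ₃
  have hΓ₄0 : 0 ≤ Γ₄ := hG₄0.trans hΓ₄
  set T₁ : ℝ := 16 * ((d : ℝ) * L) * (6 * G₁ + 2 * G₄) * l2 + K₁ * G₃ * l2 with hT₁
  set A₁ : ℝ := 16 * ((d : ℝ) * L) * (6 * Γ₁ + 2 * Γ₄) + K₁ * Γ₃ with hA₁
  have hA₁0 : 0 ≤ A₁ := by rw [hA₁]; positivity
  have hT₁le : T₁ ≤ A₁ * l2 := by
    rw [hT₁, hA₁]
    have h1 : 16 * ((d : ℝ) * L) * (6 * G₁ + 2 * G₄) * l2 ≤ 16 * ((d : ℝ) * L) * (6 * Γ₁ + 2 * Γ₄) * l2 := by gcongr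
    have h2 : K₁ * G₃ * l2 ≤ K₁ * Γ₃ * l2 := by gcongr
    calc 16 * ((d : ℝ) * L) * (6 * G₁ + 2 * G₄) * l2 + K₁ * G₃ * l2 ≤ 16 * ((d : ℝ) * L) * (6 * Γ₁ + 2 * Γ₄) * l2 + K₁ * Γ₃ * l2 := add_le_add h1 h2
      _ = (16 * ((d : ℝ) * L) * (6 * Γ₁ + 2 * Γ₄) + K₁ * Γ₃) * l2 := by ring
  have hl2E : l2 ≤ M ^ 2 * E ^ 2 := by
    have h := inv_sq_mul_l2sq_le_energySq L j W X F
    have hM2 : 0 < M ^ 2 := by positivity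
    have e : l2 = M ^ 2 * ((M ^ 2)⁻¹ * l2) := by field_simp
    rw [e]; exact mul_le_mul_of_nonneg_left h hM2.le
  have hx2 : x ^ 2 * M ^ 2 ≤ (M ^ 2 * x) ^ 2 := sq_mul_le_sq_of_one_le hM1
  calc x * ∑ p ∈ perWin d (N * L ^ (j + 1)), ‖curl W (gaugeDir W (spikeW (L ^ (j + 1)) (framePotW L (j + 1) W X))) p‖
      ≤ x * (2 * x * P * T₁) := mul_le_mul_of_nonneg_left hsp hx
    _ ≤ x * (2 * x * P * (A₁ * l2)) := by gcongr
    _ ≤ x * (2 * x * P * (A₁ * (M ^ 2 * E ^ 2))) := by gcongr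
    _ = 2 * P * A₁ * (x ^ 2 * M ^ 2) * E ^ 2 := by ring
    _ ≤ 2 * P * A₁ * (M ^ 2 * x) ^ 2 * E ^ 2 := by gcongr

end

end Summit.QuantumFields.BalabanUV.T4Continuum.NE7TopNormalisedSpikeEnergyLetters
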